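import Summits.QuantumFields.BalabanUV.Beta.EriceRemainderEnclosureHistoryAutonomyComparisonDefectSecondMoment
import Summits.QuantumFields.BalabanUV.Beta.EriceRemainderEnclosureHistoryAutonomyComparisonDefectRunEnclosure

/-!
# EriceRemainderEnclosureHistoryAutonomyComparisonDefectSecondMomentEnclosure — (E140l) **THE K-FREE ENCLOSURE: a sign-free `ε`-remainder (functional, pseudo-orbit, or run
# of the printed recursion shape) is enclosed between the flows of `B ∓ ε` up to the depth-independent level constant `c₂ = θ₂·2ε∕(1−θ)`, `θ₂ = Σ_k Λ_k·k(k+1)∕2` the SECOND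
# AGE MOMENT of the memory's level-Lipschitz profile.**  (E140k)'s deficit bound + its MIRROR (structured memory above an arbitrary functional: the sequence lemma applied to
# `(−X, −E)` with (E140e)'s upper link kept WITH the row's own deficit, `borrow_with_source_above`, `level_surplus_le_second`) give, for `|B′ − B| ≤ ε` (`0 ≤ ε < b`):
#   **`1∕h₋_j² − c₂ ≤ 1∕h′_j² ≤ 1∕h₊_j² + c₂`** at every `j` (`enclosure_second`), and the same for `ε`-PSEUDO-ORBITS (`pseudo_orbit_enclosure_second`, via (E140i)
# `exists_functional_of_pseudo_orbit`) and for RUNS `FlowStep.RGEqH K β g` read from the infrared end (`run_enclosure_second_at`, via (E140j) `run_increment`).  Compared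
# with (E140h)∕(E140i)∕(E140j) the constant `(K_mem−1)θ·2ε∕(1−θ)` is replaced by `θ₂·2ε∕(1−θ)` — no truncation parameter, finite for every profile with a finite second age
# moment, and of the sharp first order (the hinge-with-switch family at age `L` realises `≈ (1−θ)²·c₂∕2`... precisely `θδ(L+1)(1−θ)∕2` against `c = θ₂δ∕(1−θ) = θδ(L+1)∕(2(1−θ))`).

Cell `pub-balaban`, β-function sub-cell, BINDER row D4 «RemainderConst leaves for Bałaban's split» (`HOME/BINDER-OWNERS.md`; owner lineage `b2b-balaban-beta-an4`;
this file by co-owner #2 lineage `b2b-balaban-beta-d4-p2`, generation 108), β-FLOW TEAM duty (1), FREEZE (0) honoured (def-free; (E140k) `interval_sum_lower_second` ∕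
`level_deficit_le_second`, (E140g) `lindley_lower`, (E140h) `level_rec_upper`, (E140e) `flow_link_upper_above` ∕ `dual_steps_above` ∕ `flow_deficit_le_above`, (E140i)
`strictAnti_of_increments` ∕ `exists_functional_of_pseudo_orbit`, (E140j) `run_increment`, (E48a) `family_zero`, (E39), (E43b) BY NAME; nothing restated).

HONEST FRAMING (page 1, verbatim and binding).  *"Discharging BetaPertH makes Bałaban's UV stability UNCONDITIONAL — a real constructive-QFT result; it is
NOT the continuum limit and NOT the Clay problem."*  THIS FILE DISCHARGES NOTHING OF THE KIND.  Elementary real analysis about ABSTRACT functionals ∕ sequences on a box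
]0,γ]^ℕ and node U2's recursion SHAPE `FlowStep.RGEqH`; whether Bałaban's β_{k+1} (1.22) are `ε`-close to one structured functional with a finite second age moment is
NOT PRINTED ([I] p. 298; GAPS G-t4-U2-1∕-2) and NOT asserted.  Row D4 class UNCHANGED (critical-path width 0; instance 0∕1; D4 DISCHARGE NO DATE).  NOT B12 Thm 2, NOT
BetaPertH, NOT continuum YM, NOT Clay.

WHAT IS PROVED ([folklore]; 0 `def`, 0 sorry).  §1 `borrow_with_source_above`, **`level_surplus_le_second`**.  §2 **`enclosure_second`**.  §3 **`pseudo_orbit_enclosure_second`**,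
**`run_enclosure_second_at`**.
-/

noncomputable section
open Finset Set

namespace Summit.QuantumFields.BalabanUV.Beta.EriceRemainderEnclosureHistoryAutonomyComparisonDefectSecondMomentEnclosure

open Literature.MathematicalPhysics.QuantumFieldTheory.Balaban1983to89
open Literature.MathematicalPhysics.QuantumFieldTheory.Balaban1983to89.FlowStep (HBeta prefixOf RGEqH)
open Literature.MathematicalPhysics.QuantumFieldTheory.Balaban1983to89.T4BetaStationary
open Literature.MathematicalPhysics.QuantumFieldTheory.Balaban1983to89.T4BetaFlowWellPosed
open Summit.QuantumFields.BalabanUV.Beta.EriceRemainderEnclosureHistoryAutonomyOrder (family_zero)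
open Summit.QuantumFields.BalabanUV.Beta.EriceRemainderEnclosureHistoryAutonomyComparisonDefectAbove
  (flow_link_upper_above dual_steps_above flow_deficit_le_above)
open Summit.QuantumFields.BalabanUV.Beta.EriceRemainderEnclosureHistoryAutonomyComparisonDefectUniform (lindley_lower)
open Summit.QuantumFields.BalabanUV.Beta.EriceRemainderEnclosureHistoryAutonomyComparisonDefectUniformEnclosure (level_rec_upper)
open Summit.QuantumFields.BalabanUV.Beta.EriceRemainderEnclosureHistoryAutonomyComparisonDefectPseudoOrbit
  (strictAnti_of_increments exists_functional_of_pseudo_orbit)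
open Summit.QuantumFields.BalabanUV.Beta.EriceRemainderEnclosureHistoryAutonomyComparisonDefectRunEnclosure (run_increment)
open Summit.QuantumFields.BalabanUV.Beta.EriceRemainderEnclosureHistoryAutonomyComparisonDefectSecondMoment
  (interval_sum_lower_second level_deficit_le_second)

variable {B B' : (ℕ → ℝ) → ℝ} {M γ b : ℝ} {S : ℝ → ℕ → ℝ} {β : HBeta} {g h h' hlo hup : ℕ → ℝ}

/-! ## §1 The mirror: the surplus of an orbit below a structured memory, second-moment form -/

/-- BORROWING WITH THE ROW'S OWN DEFICIT, `B′` below: `X⁺_n ≤ (Σ_{k<K} Λ_k Σ_{l<k} X⁻_{n+l+1} − (B−B′)(tail_{n+1}h′))⁺` — (E140e)'s upper link with the `l = 0` terms dead when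
`X_n > 0`. [folklore] -/
theorem borrow_with_source_above {Λ : ℕ → ℝ} {K : ℕ} (hb : 0 < b)
    (hmono : ∀ u v : ℕ → ℝ, SeqBox γ u → SeqBox γ v → (∀ i, u i ≤ v i) → B u ≤ B v)
    (hB : ∀ u u' : ℕ → ℝ, SeqBox γ u → SeqBox γ u' → ∀ D : ℝ, (∀ j, |u j - u' j| ≤ D) → |B u - B u'| ≤ M * D) (hM : 0 ≤ M)
    (hlo : ∀ u, SeqBox γ u → b ≤ B u) (hlo' : ∀ u, SeqBox γ u → b ≤ B' u)
    (hS : ∀ p, 0 < p → p ≤ γ → SeqBox γ (S p) ∧ MemFlow B p (S p))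
    (huniq : ∀ p, 0 < p → p ≤ γ → ∀ u u' : ℕ → ℝ, SeqBox γ u → SeqBox γ u' → MemFlow B p u → MemFlow B p u' → u = u')
    (hΛ : ∀ k, 0 ≤ Λ k)
    (hLip : ∀ u v : ℕ → ℝ, SeqBox γ u → SeqBox γ v → (∀ k : ℕ, 1 / γ ^ 2 + ((k : ℝ) + 1) * b ≤ 1 / u k ^ 2) →
      (∀ k : ℕ, 1 / γ ^ 2 + ((k : ℝ) + 1) * b ≤ 1 / v k ^ 2) → B u - B v ≤ ∑ k ∈ range K, Λ k * max (1 / v k ^ 2 - 1 / u k ^ 2) 0)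
    (hh' : SeqBox γ h') {y : ℝ} (hy : 0 < y) (hyγ : y ≤ γ) (hf' : MemFlow B' y h') (n : ℕ) :
    max (-(-(1 / h' (n + 1) ^ 2 - 1 / S (h' n) 1 ^ 2))) 0
      ≤ max (∑ k ∈ range K, Λ k * ∑ l ∈ range k, max (-(1 / h' (n + (l + 1) + 1) ^ 2 - 1 / S (h' (n + (l + 1))) 1 ^ 2)) 0
          - (-(B' (fun i => h' (n + 1 + i)) - B (fun i => h' (n + 1 + i))))) 0 := by
  have hlink := flow_link_upper_above hb hmono hB hM hlo hlo' hS huniq hΛ hLip hh' hy hyγ hf' n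
  rw [neg_neg]
  by_cases hX : 1 / h' (n + 1) ^ 2 - 1 / S (h' n) 1 ^ 2 ≤ 0
  · rw [max_eq_right hX]; exact le_max_right _ _
  · have hX' : 0 < 1 / h' (n + 1) ^ 2 - 1 / S (h' n) 1 ^ 2 := lt_of_not_ge hX
    rw [max_eq_left hX'.le]
    have hz : max (-(1 / h' (n + 0 + 1) ^ 2 - 1 / S (h' (n + 0)) 1 ^ 2)) 0 = 0 := by
      simp only [Nat.add_zero]; exact max_eq_right (by linarith)
    have hsplit : ∀ k ∈ range K, Λ k * ∑ l ∈ range (k + 1), max (-(1 / h' (n + l + 1) ^ 2 - 1 / S (h' (n + l)) 1 ^ 2)) 0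
        = Λ k * ∑ l ∈ range k, max (-(1 / h' (n + (l + 1) + 1) ^ 2 - 1 / S (h' (n + (l + 1))) 1 ^ 2)) 0 := by
      intro k _
      rw [sum_range_succ', hz, add_zero]
    rw [sum_congr rfl hsplit] at hlink
    refine le_trans ?_ (le_max_left _ _)
    linarith

/-- **THE SURPLUS OF AN ORBIT BELOW A STRUCTURED MEMORY, SECOND-MOMENT FORM: `1∕h′_j² ≤ 1∕h_j² + θ₂(δ + θδ∕(1−θ))` UNIFORMLY IN `j`.**  `B`: isotone on `]0,γ]^ℕ`, zeroth
moment `M`, `B ≤ β̄`, level-Lipschitz age profile `Λ ≥ 0` on `range K` over the graded box (grading `b`), `θ = Σ_{k<K} k·Λ_k < 1`, `θ₂ = Σ_k Λ_k Σ_{l<k}(l+1)`.  `B′`: ANY functional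
with `b ≤ B′ ≤ B` (`b > 0`) whose deficit `D = B − B′` satisfies `u ≤ v ⟹ D u ≤ (1+τ)·D v + δ` (`τ, δ ≥ 0`), `(1+τ)θ ≤ 1`.  `h, h′`: ANY box solutions of `B, B′` from one pin.
[folklore] -/
theorem level_surplus_le_second {Λ : ℕ → ℝ} {K : ℕ} {βb p τ δ : ℝ}
    (hmono : ∀ u v : ℕ → ℝ, SeqBox γ u → SeqBox γ v → (∀ i, u i ≤ v i) → B u ≤ B v)
    (hB : ∀ u u' : ℕ → ℝ, SeqBox γ u → SeqBox γ u' → ∀ D : ℝ, (∀ j, |u j - u' j| ≤ D) → |B u - B u'| ≤ M * D) (hM : 0 ≤ M)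
    (hb : 0 < b) (hlo' : ∀ u, SeqBox γ u → b ≤ B' u) (hle : ∀ u, SeqBox γ u → B' u ≤ B u) (hbdd : ∀ u, SeqBox γ u → B u ≤ βb)
    (hΛ : ∀ k, 0 ≤ Λ k) (hθ : ∑ k ∈ range K, (k : ℝ) * Λ k < 1)
    (hτ : 0 ≤ τ) (hθτ : (1 + τ) * ∑ k ∈ range K, (k : ℝ) * Λ k ≤ 1) (hδ : 0 ≤ δ)
    (hLip : ∀ u v : ℕ → ℝ, SeqBox γ u → SeqBox γ v → (∀ k : ℕ, 1 / γ ^ 2 + ((k : ℝ) + 1) * b ≤ 1 / u k ^ 2) →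
      (∀ k : ℕ, 1 / γ ^ 2 + ((k : ℝ) + 1) * b ≤ 1 / v k ^ 2) → B u - B v ≤ ∑ k ∈ range K, Λ k * max (1 / v k ^ 2 - 1 / u k ^ 2) 0)
    (hDdef : ∀ u v : ℕ → ℝ, SeqBox γ u → SeqBox γ v → (∀ i, u i ≤ v i) → B u - B' u ≤ (1 + τ) * (B v - B' v) + δ)
    (hp : 0 < p) (hpγ : p ≤ γ) (hh : SeqBox γ h) (hf : MemFlow B p h) (hh' : SeqBox γ h') (hf' : MemFlow B' p h') (j : ℕ) :
    1 / h' j ^ 2 ≤ 1 / h j ^ 2 + (∑ k ∈ range K, Λ k * ∑ l ∈ range k, ((l : ℝ) + 1))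
        * (δ + (∑ k ∈ range K, (k : ℝ) * Λ k) * δ / (1 - ∑ k ∈ range K, (k : ℝ) * Λ k)) := by
  set F : ℝ := (∑ k ∈ range K, (k : ℝ) * Λ k) * δ / (1 - ∑ k ∈ range K, (k : ℝ) * Λ k) with hFdef
  set θ₂ : ℝ := ∑ k ∈ range K, Λ k * ∑ l ∈ range k, ((l : ℝ) + 1) with hθ₂
  have hlo : ∀ u, SeqBox γ u → b ≤ B u := fun u hu => (hlo' u hu).trans (hle u hu)
  have hex : ∀ q : ℝ, 0 < q → q ≤ γ → ∃ k : ℕ → ℝ, SeqBox γ k ∧ MemFlow B q k :=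
    fun q hq hqγ => Summit.QuantumFields.BalabanUV.Beta.EriceRemainderEnclosureHistoryAutonomyExistence.exists_memFlow_zm hB hM hq hqγ hb hlo
  choose! S hSb hSf using hex
  have hS : ∀ q, 0 < q → q ≤ γ → SeqBox γ (S q) ∧ MemFlow B q (S q) := fun q hq hqγ => ⟨hSb q hq hqγ, hSf q hq hqγ⟩
  have huniq : ∀ q, 0 < q → q ≤ γ → ∀ u u' : ℕ → ℝ, SeqBox γ u → SeqBox γ u' → MemFlow B q u → MemFlow B q u' → u = u' :=
    fun q hq _ u u' hu hu' hfu hfu' =>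
      Summit.QuantumFields.BalabanUV.Beta.EriceRemainderEnclosureHistoryAutonomyMonotoneGeneral.memFlow_unique_of_monotone_zm
        hmono hB hM hq hb hlo hu hu' hfu hfu'
  have e : h = S p := huniq p hp hpγ _ _ hh (hS p hp hpγ).1 hf (hS p hp hpγ).2
  have hθ0 : 0 ≤ ∑ k ∈ range K, (k : ℝ) * Λ k := sum_nonneg fun k _ => mul_nonneg (Nat.cast_nonneg k) (hΛ k)
  have hF0 : 0 ≤ F := div_nonneg (mul_nonneg hθ0 hδ) (by linarith)
  -- Lindley for (−L, −X) with the second-moment interval bound for (−X, −E)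
  have key := lindley_lower (L := fun j => -(1 / h' j ^ 2 - 1 / S p j ^ 2)) (X := fun m => -(1 / h' (m + 1) ^ 2 - 1 / S (h' m) 1 ^ 2))
    (C := θ₂ * (δ + F))
    (by show 0 ≤ -(1 / h' 0 ^ 2 - 1 / S p 0 ^ 2); rw [hf'.1, family_zero hS hp hpγ]; simp)
    (fun j => by
      have hr := level_rec_upper hb hmono hB hM hlo hS huniq hh' hp hpγ j
      have e1 : min (-(1 / h' j ^ 2 - 1 / S p j ^ 2)) 0 = -max (1 / h' j ^ 2 - 1 / S p j ^ 2) 0 := by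
        rcases le_total (1 / h' j ^ 2 - 1 / S p j ^ 2) 0 with hx | hx
        · rw [max_eq_right hx, min_eq_right (by linarith), neg_zero]
        · rw [max_eq_left hx, min_eq_left (by linarith)]
      show -(1 / h' (j + 1) ^ 2 - 1 / S (h' j) 1 ^ 2) + min (-(1 / h' j ^ 2 - 1 / S p j ^ 2)) 0 ≤ -(1 / h' (j + 1) ^ 2 - 1 / S p (j + 1) ^ 2)
      rw [e1]
      linarith)
    (fun i t => by
      have hint := interval_sum_lower_second (X := fun m => -(1 / h' (m + 1) ^ 2 - 1 / S (h' m) 1 ^ 2))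
        (E := fun m => -(B' (fun i => h' (m + 1 + i)) - B (fun i => h' (m + 1 + i)))) hΛ hθ.le hθτ hτ hδ hF0
        (fun m => by have := hle _ (fun i => hh' (m + 1 + i)); show 0 ≤ -(B' (fun i => h' (m + 1 + i)) - B (fun i => h' (m + 1 + i))); linarith)
        (fun m l => flow_deficit_le_above hb hlo' hDdef hh' hf' m l)
        (fun n => by
          have := (dual_steps_above hb hmono hB hM hlo' hle hbdd hS huniq hΛ hθ hτ hθτ hδ hLip hDdef hh' hp hpγ hf' n).2
          show -(1 / h' (n + 1) ^ 2 - 1 / S (h' n) 1 ^ 2) - -(B' (fun i => h' (n + 1 + i)) - B (fun i => h' (n + 1 + i))) ≤ F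
          linarith)
        (fun n => borrow_with_source_above hb hmono hB hM hlo hlo' hS huniq hΛ hLip hh' hp hpγ hf' n) i t
      exact hint) j
  have key' : -(θ₂ * (δ + F)) ≤ -(1 / h' j ^ 2 - 1 / S p j ^ 2) := key
  rw [e]
  linarith

/-! ## §2 The K-free enclosure of a sign-free `ε`-remainder -/

/-- **THE K-FREE ENCLOSURE.**  `B`: isotone on the box `]0,γ]^ℕ`, zeroth moment `M`, floor `b`, `B ≤ β̄`, level-Lipschitz age profile `Λ ≥ 0` on `range K` over the box graded by
`b − ε`, `θ := Σ_{k<K} k·Λ_k < 1`, `θ₂ := Σ_{k<K} Λ_k Σ_{l<k}(l+1)` (`= Σ_k Λ_k·k(k+1)∕2`).  `B′`: ANY functional with **`|B′ u − B u| ≤ ε`** on the box, `0 ≤ ε < b`.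
`h₋, h₊, h′`: ANY box solutions of `B − ε`, `B + ε`, `B′` from one pin `p`.  Then with **`c₂ := θ₂·(2ε + θ·2ε∕(1−θ)) = θ₂·2ε∕(1−θ)`**, at EVERY scale `j`:
**`1∕h₋_j² − c₂ ≤ 1∕h′_j² ≤ 1∕h₊_j² + c₂`** — no truncation parameter `K` in the constant ((E140h) had `(K−1)θ·2ε∕(1−θ)`). [folklore] -/
theorem enclosure_second {Λ : ℕ → ℝ} {K : ℕ} {βb p ε : ℝ}
    (hmono : ∀ u v : ℕ → ℝ, SeqBox γ u → SeqBox γ v → (∀ i, u i ≤ v i) → B u ≤ B v)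
    (hB : ∀ u u' : ℕ → ℝ, SeqBox γ u → SeqBox γ u' → ∀ D : ℝ, (∀ j, |u j - u' j| ≤ D) → |B u - B u'| ≤ M * D) (hM : 0 ≤ M)
    (hε : 0 ≤ ε) (hεb : ε < b) (hlow : ∀ u, SeqBox γ u → b ≤ B u) (hbdd : ∀ u, SeqBox γ u → B u ≤ βb)
    (hΛ : ∀ k, 0 ≤ Λ k) (hθ : ∑ k ∈ range K, (k : ℝ) * Λ k < 1)
    (hLip : ∀ u v : ℕ → ℝ, SeqBox γ u → SeqBox γ v → (∀ k : ℕ, 1 / γ ^ 2 + ((k : ℝ) + 1) * (b - ε) ≤ 1 / u k ^ 2) →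
      (∀ k : ℕ, 1 / γ ^ 2 + ((k : ℝ) + 1) * (b - ε) ≤ 1 / v k ^ 2) → B u - B v ≤ ∑ k ∈ range K, Λ k * max (1 / v k ^ 2 - 1 / u k ^ 2) 0)
    (hpert : ∀ u, SeqBox γ u → |B' u - B u| ≤ ε)
    (hp : 0 < p) (hpγ : p ≤ γ) (hhlo : SeqBox γ hlo) (hflo : MemFlow (fun w => B w + -ε) p hlo)
    (hhup : SeqBox γ hup) (hfup : MemFlow (fun w => B w + ε) p hup) (hh' : SeqBox γ h') (hf' : MemFlow B' p h') (j : ℕ) :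
    1 / hlo j ^ 2 - (∑ k ∈ range K, Λ k * ∑ l ∈ range k, ((l : ℝ) + 1))
          * (2 * ε + (∑ k ∈ range K, (k : ℝ) * Λ k) * (2 * ε) / (1 - ∑ k ∈ range K, (k : ℝ) * Λ k)) ≤ 1 / h' j ^ 2
      ∧ 1 / h' j ^ 2 ≤ 1 / hup j ^ 2 + (∑ k ∈ range K, Λ k * ∑ l ∈ range k, ((l : ℝ) + 1))
          * (2 * ε + (∑ k ∈ range K, (k : ℝ) * Λ k) * (2 * ε) / (1 - ∑ k ∈ range K, (k : ℝ) * Λ k)) := by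
  have hb0 : 0 < b - ε := by linarith
  have hε2 : 0 ≤ 2 * ε := by linarith
  have hθ0 : 0 ≤ ∑ k ∈ range K, (k : ℝ) * Λ k := sum_nonneg fun k _ => mul_nonneg (Nat.cast_nonneg k) (hΛ k)
  have hθτ : (1 + (0 : ℝ)) * ∑ k ∈ range K, (k : ℝ) * Λ k ≤ 1 := by linarith
  have hmono_s : ∀ c : ℝ, ∀ u v : ℕ → ℝ, SeqBox γ u → SeqBox γ v → (∀ i, u i ≤ v i) → (fun w => B w + c) u ≤ (fun w => B w + c) v :=
    fun c u v hu hv huv => by show B u + c ≤ B v + c; linarith [hmono u v hu hv huv]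
  have hzm_s : ∀ c : ℝ, ∀ u u' : ℕ → ℝ, SeqBox γ u → SeqBox γ u' → ∀ D : ℝ, (∀ j, |u j - u' j| ≤ D) →
      |(fun w => B w + c) u - (fun w => B w + c) u'| ≤ M * D := fun c u u' hu hu' D hD => by
    show |B u + c - (B u' + c)| ≤ M * D
    rw [show B u + c - (B u' + c) = B u - B u' by ring]
    exact hB u u' hu hu' D hD
  have hLip_s : ∀ c : ℝ, ∀ u v : ℕ → ℝ, SeqBox γ u → SeqBox γ v → (∀ k : ℕ, 1 / γ ^ 2 + ((k : ℝ) + 1) * (b - ε) ≤ 1 / u k ^ 2) →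
      (∀ k : ℕ, 1 / γ ^ 2 + ((k : ℝ) + 1) * (b - ε) ≤ 1 / v k ^ 2) →
      (fun w => B w + c) u - (fun w => B w + c) v ≤ ∑ k ∈ range K, Λ k * max (1 / v k ^ 2 - 1 / u k ^ 2) 0 :=
    fun c u v hu hv hgu hgv => by
      show B u + c - (B v + c) ≤ _
      rw [show B u + c - (B v + c) = B u - B v by ring]
      exact hLip u v hu hv hgu hgv
  constructor
  · have hlo0 : ∀ u, SeqBox γ u → b - ε ≤ (fun w => B w + -ε) u := fun u hu => by
      show b - ε ≤ B u + -ε; linarith [hlow u hu]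
    have hexc : ∀ u, SeqBox γ u → (fun w => B w + -ε) u ≤ B' u := fun u hu => by
      show B u + -ε ≤ B' u; linarith [(abs_le.mp (hpert u hu)).1]
    have hbdd' : ∀ u, SeqBox γ u → B' u ≤ βb + ε := fun u hu => by
      linarith [(abs_le.mp (hpert u hu)).2, hbdd u hu]
    have hDosc : ∀ u v : ℕ → ℝ, SeqBox γ u → SeqBox γ v → (∀ i, u i ≤ v i) →
        B' u - (fun w => B w + -ε) u ≤ (1 + (0 : ℝ)) * (B' v - (fun w => B w + -ε) v) + 2 * ε := fun u v hu hv _ => by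
      show B' u - (B u + -ε) ≤ (1 + 0) * (B' v - (B v + -ε)) + 2 * ε
      linarith [(abs_le.mp (hpert u hu)).2, (abs_le.mp (hpert v hv)).1]
    exact level_deficit_le_second (B := fun w => B w + -ε) (B' := B') (hmono_s (-ε)) (hzm_s (-ε)) hM hb0 hlo0 hΛ hθ le_rfl hθτ hε2
      (hLip_s (-ε)) hexc hbdd' hDosc hp hpγ hhlo hflo hh' hf' j
  · have hlo' : ∀ u, SeqBox γ u → b - ε ≤ B' u := fun u hu => by
      linarith [(abs_le.mp (hpert u hu)).1, hlow u hu]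
    have hle : ∀ u, SeqBox γ u → B' u ≤ (fun w => B w + ε) u := fun u hu => by
      show B' u ≤ B u + ε; linarith [(abs_le.mp (hpert u hu)).2]
    have hbdd' : ∀ u, SeqBox γ u → (fun w => B w + ε) u ≤ βb + ε := fun u hu => by
      show B u + ε ≤ βb + ε; linarith [hbdd u hu]
    have hDdef : ∀ u v : ℕ → ℝ, SeqBox γ u → SeqBox γ v → (∀ i, u i ≤ v i) →
        (fun w => B w + ε) u - B' u ≤ (1 + (0 : ℝ)) * ((fun w => B w + ε) v - B' v) + 2 * ε := fun u v hu hv _ => by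
      show B u + ε - B' u ≤ (1 + 0) * (B v + ε - B' v) + 2 * ε
      linarith [(abs_le.mp (hpert u hu)).1, (abs_le.mp (hpert v hv)).2]
    exact level_surplus_le_second (B := fun w => B w + ε) (B' := B') (hmono_s ε) (hzm_s ε) hM hb0 hlo' hle hbdd' hΛ hθ le_rfl hθτ hε2
      (hLip_s ε) hDdef hp hpγ hhup hfup hh' hf' j

/-! ## §3 Pseudo-orbits and runs, K-free constant -/

/-- **K-FREE PSEUDO-ORBIT ENCLOSURE**: `h′` ANY box sequence with `h′ 0 = p` and `|1∕h′_{m+1}² − 1∕h′_m² − B(h′_{m+1}, h′_{m+2}, …)| ≤ ε` for all `m`; same conclusion as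
`enclosure_second` ((E140i)'s functional `B″` on the distinct tails). [folklore] -/
theorem pseudo_orbit_enclosure_second {Λ : ℕ → ℝ} {K : ℕ} {βb p ε : ℝ}
    (hmono : ∀ u v : ℕ → ℝ, SeqBox γ u → SeqBox γ v → (∀ i, u i ≤ v i) → B u ≤ B v)
    (hB : ∀ u u' : ℕ → ℝ, SeqBox γ u → SeqBox γ u' → ∀ D : ℝ, (∀ j, |u j - u' j| ≤ D) → |B u - B u'| ≤ M * D) (hM : 0 ≤ M)
    (hε : 0 ≤ ε) (hεb : ε < b) (hlow : ∀ u, SeqBox γ u → b ≤ B u) (hbdd : ∀ u, SeqBox γ u → B u ≤ βb)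
    (hΛ : ∀ k, 0 ≤ Λ k) (hθ : ∑ k ∈ range K, (k : ℝ) * Λ k < 1)
    (hLip : ∀ u v : ℕ → ℝ, SeqBox γ u → SeqBox γ v → (∀ k : ℕ, 1 / γ ^ 2 + ((k : ℝ) + 1) * (b - ε) ≤ 1 / u k ^ 2) →
      (∀ k : ℕ, 1 / γ ^ 2 + ((k : ℝ) + 1) * (b - ε) ≤ 1 / v k ^ 2) → B u - B v ≤ ∑ k ∈ range K, Λ k * max (1 / v k ^ 2 - 1 / u k ^ 2) 0)
    (hp : 0 < p) (hpγ : p ≤ γ) (hhlo : SeqBox γ hlo) (hflo : MemFlow (fun w => B w + -ε) p hlo)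
    (hhup : SeqBox γ hup) (hfup : MemFlow (fun w => B w + ε) p hup)
    (hh' : SeqBox γ h') (hp0 : h' 0 = p)
    (hps : ∀ m, |1 / h' (m + 1) ^ 2 - 1 / h' m ^ 2 - B (fun j => h' (m + 1 + j))| ≤ ε) (j : ℕ) :
    1 / hlo j ^ 2 - (∑ k ∈ range K, Λ k * ∑ l ∈ range k, ((l : ℝ) + 1))
          * (2 * ε + (∑ k ∈ range K, (k : ℝ) * Λ k) * (2 * ε) / (1 - ∑ k ∈ range K, (k : ℝ) * Λ k)) ≤ 1 / h' j ^ 2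
      ∧ 1 / h' j ^ 2 ≤ 1 / hup j ^ 2 + (∑ k ∈ range K, Λ k * ∑ l ∈ range k, ((l : ℝ) + 1))
          * (2 * ε + (∑ k ∈ range K, (k : ℝ) * Λ k) * (2 * ε) / (1 - ∑ k ∈ range K, (k : ℝ) * Λ k)) := by
  have hinc : ∀ m, 1 / h' m ^ 2 < 1 / h' (m + 1) ^ 2 := fun m => by
    have h1 := (abs_le.mp (hps m)).1
    have h2 := hlow _ (fun j => hh' (m + 1 + j))
    linarith
  have hanti := strictAnti_of_increments (fun m => (hh' m).1) hinc
  obtain ⟨B'', htail, hoff⟩ := exists_functional_of_pseudo_orbit hanti (fun m => 1 / h' (m + 1) ^ 2 - 1 / h' m ^ 2) B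
  have hf' : MemFlow B'' p h' := ⟨hp0, fun m => by rw [htail m]; ring⟩
  have hpert : ∀ u, SeqBox γ u → |B'' u - B u| ≤ ε := by
    intro u _
    by_cases hu : ∃ m, u = fun j => h' (m + 1 + j)
    · obtain ⟨m, rfl⟩ := hu
      rw [htail m]
      exact hps m
    · rw [hoff u hu, sub_self, abs_zero]
      exact hε
  exact enclosure_second hmono hB hM hε hεb hlow hbdd hΛ hθ hLip hpert hp hpγ hhlo hflo hhup hfup hh' hf' j

/-- **K-FREE RUN ENCLOSURE, AT THE RUN'S OWN SCALES**: a run `RGEqH K β g` of node U2's history-dependent recursion shape read from its infrared end (`h′_j = g_{K−j}`,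
`j ≤ K`, continued into the UV by any box sequence) under the ScaleShiftRate-TYPE closeness `|β_{k+1}(g_0, …, g_k) − B(h′_{K−k}, h′_{K−k+1}, …)| ≤ ε` (`k < K`) and the
continuation's increments within `ε` of `B`:  `1∕h₋_j² − c₂ ≤ 1∕g_{K−j}² ≤ 1∕h₊_j² + c₂` for `j ≤ K`, `c₂ = θ₂·2ε∕(1−θ)` — independent of the depth `K` AND of any memory truncation.
[folklore] -/
theorem run_enclosure_second_at {Λ : ℕ → ℝ} {Kmem : ℕ} {βb p ε : ℝ} {K : ℕ}
    (hmono : ∀ u v : ℕ → ℝ, SeqBox γ u → SeqBox γ v → (∀ i, u i ≤ v i) → B u ≤ B v)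
    (hB : ∀ u u' : ℕ → ℝ, SeqBox γ u → SeqBox γ u' → ∀ D : ℝ, (∀ j, |u j - u' j| ≤ D) → |B u - B u'| ≤ M * D) (hM : 0 ≤ M)
    (hε : 0 ≤ ε) (hεb : ε < b) (hlow : ∀ u, SeqBox γ u → b ≤ B u) (hbdd : ∀ u, SeqBox γ u → B u ≤ βb)
    (hΛ : ∀ k, 0 ≤ Λ k) (hθ : ∑ k ∈ range Kmem, (k : ℝ) * Λ k < 1)
    (hLip : ∀ u v : ℕ → ℝ, SeqBox γ u → SeqBox γ v → (∀ k : ℕ, 1 / γ ^ 2 + ((k : ℝ) + 1) * (b - ε) ≤ 1 / u k ^ 2) →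
      (∀ k : ℕ, 1 / γ ^ 2 + ((k : ℝ) + 1) * (b - ε) ≤ 1 / v k ^ 2) → B u - B v ≤ ∑ k ∈ range Kmem, Λ k * max (1 / v k ^ 2 - 1 / u k ^ 2) 0)
    (hp : 0 < p) (hpγ : p ≤ γ) (hhlo : SeqBox γ hlo) (hflo : MemFlow (fun w => B w + -ε) p hlo)
    (hhup : SeqBox γ hup) (hfup : MemFlow (fun w => B w + ε) p hup)
    (hrun : RGEqH K β g) (hh' : SeqBox γ h') (hp0 : h' 0 = p) (hrev : ∀ j, j ≤ K → h' j = g (K - j))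
    (hclose : ∀ k, k < K → |β k (prefixOf g k) - B (fun j => h' (K - k + j))| ≤ ε)
    (hcont : ∀ m, K ≤ m → |1 / h' (m + 1) ^ 2 - 1 / h' m ^ 2 - B (fun j => h' (m + 1 + j))| ≤ ε) {j : ℕ} (hj : j ≤ K) :
    1 / hlo j ^ 2 - (∑ k ∈ range Kmem, Λ k * ∑ l ∈ range k, ((l : ℝ) + 1))
          * (2 * ε + (∑ k ∈ range Kmem, (k : ℝ) * Λ k) * (2 * ε) / (1 - ∑ k ∈ range Kmem, (k : ℝ) * Λ k)) ≤ 1 / g (K - j) ^ 2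
      ∧ 1 / g (K - j) ^ 2 ≤ 1 / hup j ^ 2 + (∑ k ∈ range Kmem, Λ k * ∑ l ∈ range k, ((l : ℝ) + 1))
          * (2 * ε + (∑ k ∈ range Kmem, (k : ℝ) * Λ k) * (2 * ε) / (1 - ∑ k ∈ range Kmem, (k : ℝ) * Λ k)) := by
  rw [← hrev j hj]
  refine pseudo_orbit_enclosure_second hmono hB hM hε hεb hlow hbdd hΛ hθ hLip hp hpγ hhlo hflo hhup hfup hh' hp0 (fun m => ?_) j
  rcases lt_or_ge m K with hm | hm
  · rw [run_increment hrun hrev hm]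
    have et : (fun j => h' (m + 1 + j)) = (fun j => h' (K - (K - m - 1) + j)) :=
      funext fun j => by rw [show K - (K - m - 1) = m + 1 by omega]
    rw [et]
    exact hclose (K - m - 1) (by omega)
  · exact hcont m hm

end Summit.QuantumFields.BalabanUV.Beta.EriceRemainderEnclosureHistoryAutonomyComparisonDefectSecondMomentEnclosure

end
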